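/- Copyright: the b2b-balaban cell (near-miss cell 7), T⁴-continuum fan-out, NE7b swarm leaf 04 (road W-RP-VAR,
row W1).  Released under the licence of the surrounding project. -/
import Literature.MathematicalPhysics.QuantumFieldTheory.Balaban1983to89.T4WeightBudget

/-!
# History chessboard road, row W1: DRESSING — reflection positivity ∕ chessboard are needed only at `t = 0`

Summits-side support leaf of the T⁴-continuum cell (rung (B)+1 on a FINITE torus only; NOT infinite volume, NOT the
mass gap, NOT the Clay statement; NOT a proof of the spine estimate NE7b).  Row W1 of the secondary road W-RP-VAR of the
swarm claim table `t4/b2b-balaban-t4-ne7b-p1/LEAVES-NE7b.md` (v3.14, owner ruling R-OWNER-23-2; memo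
`t4/b2b-balaban-t4-ne7-p2/g27/IDEAS-NE7-g27.md` §1 (DRESS); port of the lineage scratch `g27/Sketch.lean` §1 of seat
t4-ne7-p2 gen 27, with its planted-false control kept as an `example`).  [folklore] real arithmetic over the tree record
`T4WeightBudget.RelWeightBound`; Mathlib + `T4WeightBudget` only; nothing is quoted from print and nothing printed is
asserted; no `[cite:]` tag; no `def`.

WHY.  On the road W-RP-VAR the relative weight of the bad class (node U5c's socket `RelWeightBound l₀ T A B Bad W`: in
each run `Σ_{Bad K t} A K t ≤ W K · Σ_{T K} A K t` for `|t| ≤ l₀`, `0 ≤ W K < 1`, `Σ_K W K < ∞`) is to be produced by a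
chessboard estimate, which needs reflection positivity of the UNDRESSED (`t = 0`) measure only.  The dressed term weights
`A K t τ` (source `e^{t·O}` inserted) are never asked to come from a reflection-positive state: if every term is dressed
two-sidedly, `e^{−m}·a K τ ≤ A K t τ ≤ e^{m}·a K τ` on `T K` for `|t| ≤ l₀` (e.g. `m = l₀·‖O‖_∞` for events of a positive
measure), then a relative bound `W` for the undressed weights `a` gives the relative bound `e^{2m}·W` for the dressed
ones.  The factor `e^{2m}` is `K`-independent, so summability is kept and `e^{2m}·W K < 1` holds from some `K₁` on; below
`K₁` the bad class is EMPTIED exactly as in the tree's tail packaging (`T4WeightBudget.relWeightBound_of_eventually`, the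
pattern of `T4GlobalDenominator.exists_relWeightBound_of_globalDom`).

WHAT.  §1 the one-run inequality `sum_bad_le_of_undressed` and the passage from a `|t|`-linear dressing exponent to the
constant `m = c·l₀` on `|t| ≤ l₀` (`dressing_of_linear`).  §2 the socket transfer: `relWeightBound_of_undressed` (all `K`,
side condition `e^{2m}·W K < 1`), `relWeightBound_of_undressed_eventually` (undressed bounds and the side condition from a
threshold `K₀` on; bad classes emptied below), and the THRESHOLD-FREE corollaries `exists_relWeightBound_of_undressed` ∕
`exists_relWeightBound_of_undressed_eventually` (a summable budget is eventually below `e^{−2m}`; no side condition left).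
§3 the `t = 0` reading: undressed weights := the dressed ones at `t = 0`, bad classes constant in `t`.  §4 sanity: the
planted-false control of the scratch (the dressing must be TWO-sided) and a decided instance of §1.

HONEST.  Bookkeeping on OUR weight-budget record; reflection positivity, the chessboard estimate, the extended measure
(EXT), the centred-averaging binder (VAR) and the universally-forced bound (U1) are NOT touched here (rows W2–W4 display
them); nothing of H3 ∕ (B) ∕ BetaPertH is discharged.  NE7b NOT proved; spine 0∕9.  HONEST DEPENDENCY (cell): continuum
YM on T⁴ ⇐ BetaPertH ∧ nine spine estimates (0/9 proved); BetaPertH ⇐ (D1) ∧ (D4) ∧ CAP+tail; G-an2-4 gates asym, D1 and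
NE2/3/4. -/

open Finset _root_.Filter _root_.Topology
open Literature.MathematicalPhysics.QuantumFieldTheory.Balaban1983to89
open Literature.MathematicalPhysics.QuantumFieldTheory.Balaban1983to89.T4WeightBudget

namespace Summit.QuantumFields.BalabanUV.T4Continuum.HistoryChessboardDressing

noncomputable section

/-! ## §1 One run: the dressed bad mass against the dressed total -/

section OneRun

variable {ι : Type*}

/-- **DRESSING, ONE RUN.**  If `Bad ⊆ T`, the undressed weights satisfy `Σ_{Bad} a ≤ W·Σ_T a` with `0 ≤ W`, and the
dressed weights satisfy `e^{−m}·a ≤ A ≤ e^{m}·a` on `T`, then `Σ_{Bad} A ≤ (e^{2m}·W)·Σ_T A`: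
`Σ_{Bad} A ≤ e^{m}·Σ_{Bad} a ≤ e^{m}·W·Σ_T a ≤ e^{m}·W·e^{m}·Σ_T A` (the last step uses the LOWER dressing bound, whence
`a ≤ e^{m}·A`). [folklore] -/
theorem sum_bad_le_of_undressed (Bad T : Finset ι) (a A : ι → ℝ) (m W : ℝ)
    (hsub : Bad ⊆ T) (hW : 0 ≤ W)
    (hlo : ∀ τ ∈ T, Real.exp (-m) * a τ ≤ A τ) (hhi : ∀ τ ∈ T, A τ ≤ Real.exp m * a τ)
    (hbad : ∑ τ ∈ Bad, a τ ≤ W * ∑ τ ∈ T, a τ) :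
    ∑ τ ∈ Bad, A τ ≤ (Real.exp (2 * m) * W) * ∑ τ ∈ T, A τ := by
  have hm : 0 < Real.exp m := Real.exp_pos m
  -- `a τ ≤ e^{m}·A τ` on `T` (from the lower dressing bound)
  have ha : ∀ τ ∈ T, a τ ≤ Real.exp m * A τ := by
    intro τ hτ
    have h := mul_le_mul_of_nonneg_left (hlo τ hτ) hm.le
    rw [← mul_assoc, ← Real.exp_add, add_neg_cancel, Real.exp_zero, one_mul] at h
    exact h
  calc ∑ τ ∈ Bad, A τ ≤ ∑ τ ∈ Bad, Real.exp m * a τ := sum_le_sum fun τ hτ => hhi τ (hsub hτ)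
    _ = Real.exp m * ∑ τ ∈ Bad, a τ := by rw [mul_sum]
    _ ≤ Real.exp m * (W * ∑ τ ∈ T, a τ) := mul_le_mul_of_nonneg_left hbad hm.le
    _ ≤ Real.exp m * (W * ∑ τ ∈ T, Real.exp m * A τ) :=
        mul_le_mul_of_nonneg_left (mul_le_mul_of_nonneg_left (sum_le_sum ha) hW) hm.le
    _ = (Real.exp (2 * m) * W) * ∑ τ ∈ T, A τ := by
        rw [← mul_sum, two_mul, Real.exp_add]; ring

/-- **FROM A `|t|`-LINEAR DRESSING EXPONENT TO A CONSTANT ONE.**  If a nonnegative undressed weight `a` is dressed as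
`e^{−c|t|}·a ≤ A t ≤ e^{c|t|}·a` with `0 ≤ c` (pointwise `|t·O| ≤ |t|·‖O‖_∞` for events of a positive measure), then on
the source window `|t| ≤ l₀` the two-sided bound holds with the constant exponent `m = c·l₀`. [folklore] -/
theorem dressing_of_linear {a c l₀ : ℝ} {A : ℝ → ℝ} (ha : 0 ≤ a) (hc : 0 ≤ c)
    (h : ∀ t : ℝ, Real.exp (-(c * |t|)) * a ≤ A t ∧ A t ≤ Real.exp (c * |t|) * a) {t : ℝ} (ht : |t| ≤ l₀) :
    Real.exp (-(c * l₀)) * a ≤ A t ∧ A t ≤ Real.exp (c * l₀) * a := by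
  have hct : c * |t| ≤ c * l₀ := mul_le_mul_of_nonneg_left ht hc
  refine ⟨le_trans ?_ (h t).1, (h t).2.trans ?_⟩
  · exact mul_le_mul_of_nonneg_right (Real.exp_le_exp.2 (neg_le_neg hct)) ha
  · exact mul_le_mul_of_nonneg_right (Real.exp_le_exp.2 hct) ha

end OneRun

/-! ## §2 The socket transfer: `RelWeightBound` for dressed families from the undressed one -/

section Socket

variable {ι : Type*} {l₀ m : ℝ} {T : ℕ → Finset ι} {a b : ℕ → ι → ℝ} {A B : ℕ → ℝ → ι → ℝ}
  {Bad : ℕ → ℝ → Finset ι} {W : ℕ → ℝ} {K₀ : ℕ}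

/-- **DRESSING ⇒ THE SOCKET (all `K`).**  `RelWeightBound` for undressed weights `a, b` (constant in `t`) and two-sided
dressing bounds with exponent `m` on `T K` for `|t| ≤ l₀` give `RelWeightBound` for the dressed weights with budget
`e^{2m}·W`, provided that budget stays below one for every `K` (else: `relWeightBound_of_undressed_eventually` ∕
`exists_relWeightBound_of_undressed`). [folklore] -/
theorem relWeightBound_of_undressed
    (h : RelWeightBound l₀ T (fun K _ => a K) (fun K _ => b K) Bad W)
    (hA : ∀ K t, |t| ≤ l₀ → ∀ τ ∈ T K,
      Real.exp (-m) * a K τ ≤ A K t τ ∧ A K t τ ≤ Real.exp m * a K τ)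
    (hB : ∀ K t, |t| ≤ l₀ → ∀ τ ∈ T K,
      Real.exp (-m) * b K τ ≤ B K t τ ∧ B K t τ ≤ Real.exp m * b K τ)
    (hlt : ∀ K, Real.exp (2 * m) * W K < 1) :
    RelWeightBound l₀ T A B Bad (fun K => Real.exp (2 * m) * W K) where
  bad_subset := h.bad_subset
  nonneg K := mul_nonneg (Real.exp_pos _).le (h.nonneg K)
  lt_one := hlt
  summable := h.summable.mul_left _
  bad_left K t ht :=
    sum_bad_le_of_undressed (Bad K t) (T K) (a K) (A K t) m (W K) (h.bad_subset K t ht) (h.nonneg K)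
      (fun τ hτ => (hA K t ht τ hτ).1) (fun τ hτ => (hA K t ht τ hτ).2) (h.bad_left K t ht)
  bad_right K t ht :=
    sum_bad_le_of_undressed (Bad K t) (T K) (b K) (B K t) m (W K) (h.bad_subset K t ht) (h.nonneg K)
      (fun τ hτ => (hB K t ht τ hτ).1) (fun τ hτ => (hB K t ht τ hτ).2) (h.bad_right K t ht)

/-- **DRESSING ⇒ THE SOCKET, FROM A THRESHOLD ON.**  Undressed relative bounds in both runs, `0 ≤ W K` and the side
condition `e^{2m}·W K < 1` only for `K ≥ K₀`, `Σ W < ∞`, and the dressing bounds for `K ≥ K₀`, give `RelWeightBound`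
for the dressed families with the bad classes EMPTIED and the budget ZEROED below `K₀` (the tree's tail packaging
`T4WeightBudget.relWeightBound_of_eventually`; below `K₀` the whole family is ONE class for the term-wise matching).
[folklore] -/
theorem relWeightBound_of_undressed_eventually
    (hsub : ∀ K t, |t| ≤ l₀ → K₀ ≤ K → Bad K t ⊆ T K)
    (h0 : ∀ K, K₀ ≤ K → 0 ≤ W K) (hs : Summable W)
    (hl : ∀ K t, |t| ≤ l₀ → K₀ ≤ K → ∑ τ ∈ Bad K t, a K τ ≤ W K * ∑ τ ∈ T K, a K τ)
    (hr : ∀ K t, |t| ≤ l₀ → K₀ ≤ K → ∑ τ ∈ Bad K t, b K τ ≤ W K * ∑ τ ∈ T K, b K τ)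
    (hA : ∀ K t, |t| ≤ l₀ → K₀ ≤ K → ∀ τ ∈ T K,
      Real.exp (-m) * a K τ ≤ A K t τ ∧ A K t τ ≤ Real.exp m * a K τ)
    (hB : ∀ K t, |t| ≤ l₀ → K₀ ≤ K → ∀ τ ∈ T K,
      Real.exp (-m) * b K τ ≤ B K t τ ∧ B K t τ ≤ Real.exp m * b K τ)
    (hlt : ∀ K, K₀ ≤ K → Real.exp (2 * m) * W K < 1) :
    RelWeightBound l₀ T A B (fun K t => if K₀ ≤ K then Bad K t else ∅)
      (Set.indicator {K | K₀ ≤ K} (fun K => Real.exp (2 * m) * W K)) :=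
  relWeightBound_of_eventually hsub (fun K hK => mul_nonneg (Real.exp_pos _).le (h0 K hK)) hlt (hs.mul_left _)
    (fun K t ht hK => sum_bad_le_of_undressed (Bad K t) (T K) (a K) (A K t) m (W K) (hsub K t ht hK) (h0 K hK)
      (fun τ hτ => (hA K t ht hK τ hτ).1) (fun τ hτ => (hA K t ht hK τ hτ).2) (hl K t ht hK))
    (fun K t ht hK => sum_bad_le_of_undressed (Bad K t) (T K) (b K) (B K t) m (W K) (hsub K t ht hK) (h0 K hK)
      (fun τ hτ => (hB K t ht hK τ hτ).1) (fun τ hτ => (hB K t ht hK τ hτ).2) (hr K t ht hK))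

/-- A nonnegative-free remark: a SUMMABLE budget times the `K`-independent dressing factor is eventually below one.
[folklore] -/
theorem eventually_exp_mul_lt_one (hs : Summable W) (m : ℝ) (K₀ : ℕ) :
    ∃ K₁, K₀ ≤ K₁ ∧ ∀ K, K₁ ≤ K → Real.exp (2 * m) * W K < 1 := by
  have hlim : Tendsto (fun K => Real.exp (2 * m) * W K) atTop (𝓝 0) := by
    simpa using (hs.tendsto_atTop_zero).const_mul (Real.exp (2 * m))
  obtain ⟨K₂, hK₂⟩ := eventually_atTop.1 (hlim.eventually (gt_mem_nhds one_pos))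
  exact ⟨max K₀ K₂, le_max_left _ _, fun K hK => hK₂ K ((le_max_right _ _).trans hK)⟩

/-- **THRESHOLD-FREE COROLLARY (eventual undressed bounds).**  Undressed relative bounds in both runs from `K₀` on with a
nonnegative SUMMABLE budget `W`, plus the dressing bounds from `K₀` on, give SOME `RelWeightBound` for the dressed
families: bad classes emptied below a threshold `K₁ ≥ K₀`, budget `𝟙_{K ≥ K₁}·e^{2m}·W`.  No side condition on the size
of `e^{2m}·W` is left — the dressing factor only moves the threshold (the pattern of
`T4GlobalDenominator.exists_relWeightBound_of_globalDom`). [folklore] -/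
theorem exists_relWeightBound_of_undressed_eventually
    (hsub : ∀ K t, |t| ≤ l₀ → K₀ ≤ K → Bad K t ⊆ T K)
    (h0 : ∀ K, K₀ ≤ K → 0 ≤ W K) (hs : Summable W)
    (hl : ∀ K t, |t| ≤ l₀ → K₀ ≤ K → ∑ τ ∈ Bad K t, a K τ ≤ W K * ∑ τ ∈ T K, a K τ)
    (hr : ∀ K t, |t| ≤ l₀ → K₀ ≤ K → ∑ τ ∈ Bad K t, b K τ ≤ W K * ∑ τ ∈ T K, b K τ)
    (hA : ∀ K t, |t| ≤ l₀ → K₀ ≤ K → ∀ τ ∈ T K,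
      Real.exp (-m) * a K τ ≤ A K t τ ∧ A K t τ ≤ Real.exp m * a K τ)
    (hB : ∀ K t, |t| ≤ l₀ → K₀ ≤ K → ∀ τ ∈ T K,
      Real.exp (-m) * b K τ ≤ B K t τ ∧ B K t τ ≤ Real.exp m * b K τ) :
    ∃ K₁, K₀ ≤ K₁ ∧ RelWeightBound l₀ T A B (fun K t => if K₁ ≤ K then Bad K t else ∅)
      (Set.indicator {K | K₁ ≤ K} (fun K => Real.exp (2 * m) * W K)) := by
  obtain ⟨K₁, h01, hK₁⟩ := eventually_exp_mul_lt_one hs m K₀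
  refine ⟨K₁, h01, ?_⟩
  exact relWeightBound_of_undressed_eventually (fun K t ht hK => hsub K t ht (h01.trans hK))
    (fun K hK => h0 K (h01.trans hK)) hs (fun K t ht hK => hl K t ht (h01.trans hK))
    (fun K t ht hK => hr K t ht (h01.trans hK)) (fun K t ht hK => hA K t ht (h01.trans hK))
    (fun K t ht hK => hB K t ht (h01.trans hK)) hK₁

/-- **THRESHOLD-FREE COROLLARY (undressed socket).**  `RelWeightBound` for the undressed (t-constant) families and the
dressing bounds give SOME `RelWeightBound` for the dressed families (bad classes emptied below a threshold `K₁`, budget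
`𝟙_{K ≥ K₁}·e^{2m}·W`) — reflection positivity ∕ the chessboard estimate are thus only ever needed at `t = 0`.
[folklore] -/
theorem exists_relWeightBound_of_undressed
    (h : RelWeightBound l₀ T (fun K _ => a K) (fun K _ => b K) Bad W)
    (hA : ∀ K t, |t| ≤ l₀ → ∀ τ ∈ T K,
      Real.exp (-m) * a K τ ≤ A K t τ ∧ A K t τ ≤ Real.exp m * a K τ)
    (hB : ∀ K t, |t| ≤ l₀ → ∀ τ ∈ T K,
      Real.exp (-m) * b K τ ≤ B K t τ ∧ B K t τ ≤ Real.exp m * b K τ) :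
    ∃ K₁, RelWeightBound l₀ T A B (fun K t => if K₁ ≤ K then Bad K t else ∅)
      (Set.indicator {K | K₁ ≤ K} (fun K => Real.exp (2 * m) * W K)) := by
  obtain ⟨K₁, -, hW⟩ := exists_relWeightBound_of_undressed_eventually (K₀ := 0) (m := m) (A := A) (B := B)
    (fun K t ht _ => h.bad_subset K t ht) (fun K _ => h.nonneg K) h.summable
    (fun K t ht _ => h.bad_left K t ht) (fun K t ht _ => h.bad_right K t ht)
    (fun K t ht _ => hA K t ht) (fun K t ht _ => hB K t ht)
  exact ⟨K₁, hW⟩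

end Socket

/-! ## §3 The `t = 0` reading: undressed weights are the dressed ones at `t = 0` -/

section TimeZero

variable {ι : Type*} {l₀ m : ℝ} {T : ℕ → Finset ι} {A B : ℕ → ℝ → ι → ℝ} {Bad : ℕ → Finset ι} {W : ℕ → ℝ}
  {K₀ : ℕ}

/-- **THE `t = 0` READING.**  With `t`-independent bad classes, relative bounds for the two runs AT `t = 0` only (where the
measure is undressed) from `K₀` on, a nonnegative summable budget, and the two-sided dressing of every term against its
own `t = 0` value, `e^{−m}·A K 0 τ ≤ A K t τ ≤ e^{m}·A K 0 τ` for `|t| ≤ l₀`, give SOME `RelWeightBound` for the dressed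
families on the whole source window (threshold `K₁ ≥ K₀`, budget `𝟙_{K ≥ K₁}·e^{2m}·W`). [folklore] -/
theorem exists_relWeightBound_of_time_zero
    (hsub : ∀ K, K₀ ≤ K → Bad K ⊆ T K) (h0 : ∀ K, K₀ ≤ K → 0 ≤ W K) (hs : Summable W)
    (hl : ∀ K, K₀ ≤ K → ∑ τ ∈ Bad K, A K 0 τ ≤ W K * ∑ τ ∈ T K, A K 0 τ)
    (hr : ∀ K, K₀ ≤ K → ∑ τ ∈ Bad K, B K 0 τ ≤ W K * ∑ τ ∈ T K, B K 0 τ)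
    (hA : ∀ K t, |t| ≤ l₀ → K₀ ≤ K → ∀ τ ∈ T K,
      Real.exp (-m) * A K 0 τ ≤ A K t τ ∧ A K t τ ≤ Real.exp m * A K 0 τ)
    (hB : ∀ K t, |t| ≤ l₀ → K₀ ≤ K → ∀ τ ∈ T K,
      Real.exp (-m) * B K 0 τ ≤ B K t τ ∧ B K t τ ≤ Real.exp m * B K 0 τ) :
    ∃ K₁, K₀ ≤ K₁ ∧ RelWeightBound l₀ T A B (fun K _ => if K₁ ≤ K then Bad K else ∅)
      (Set.indicator {K | K₁ ≤ K} (fun K => Real.exp (2 * m) * W K)) :=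
  exists_relWeightBound_of_undressed_eventually (a := fun K => A K 0) (b := fun K => B K 0) (Bad := fun K _ => Bad K)
    (fun K _ _ hK => hsub K hK) h0 hs (fun K _ _ hK => hl K hK) (fun K _ _ hK => hr K hK) hA hB

end TimeZero

/-! ## §4 Sanity -/

namespace Sanity

/-- CONTROL (planted false, from the scratch): the dressing constant is genuinely TWO-sided — a one-sided bound
`A ≤ e^{m}·a` alone does not bound `Σ_{Bad} A ∕ Σ_T A` (take `A = 0` off `Bad`): here the ratio is `1` although
`W = 1∕2`. -/
example : ∃ (a A : Bool → ℝ), (∀ τ, 0 ≤ a τ) ∧ (∀ τ, A τ ≤ Real.exp 0 * a τ) ∧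
    (∑ τ ∈ ({true} : Finset Bool), a τ ≤ (1/2 : ℝ) * ∑ τ, a τ) ∧
    ¬ (∑ τ ∈ ({true} : Finset Bool), A τ ≤ (1/2 : ℝ) * ∑ τ, A τ) := by
  refine ⟨fun _ => 1, fun τ => if τ then 1 else 0, fun _ => by norm_num, fun τ => ?_, ?_, ?_⟩
  · cases τ <;> simp
  · simp
  · norm_num

/-- POSITIVE INSTANCE of §1 (decided up to `Real.exp 0 = 1`): two terms of undressed weight `1`, bad class `{true}`,
`W = 1∕2`, trivially dressed (`m = 0`, `A = a`): the conclusion `Σ_{Bad} A ≤ e^{0}·(1∕2)·Σ_T A` reads `1 ≤ 1`. -/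
example : ∑ τ ∈ ({true} : Finset Bool), (fun _ : Bool => (1 : ℝ)) τ ≤
    (Real.exp (2 * 0) * (1/2 : ℝ)) * ∑ τ ∈ (univ : Finset Bool), (fun _ : Bool => (1 : ℝ)) τ :=
  sum_bad_le_of_undressed {true} univ (fun _ => 1) (fun _ => 1) 0 (1/2) (subset_univ _) (by norm_num)
    (fun _ _ => by simp) (fun _ _ => by simp) (by simp)

end Sanity

end

end Summit.QuantumFields.BalabanUV.T4Continuum.HistoryChessboardDressing
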